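import Summits.ABC.IUTFork.Cor312LicenceBallPairsGenuineK
import Summits.ABC.IUTFork.Cor312LicenceTameBoundarySubsumesTame
import HarnessLib

/-!
# [IUTchIII] Cor. 3.12, branch C — the PAIR deciders at torsion-free sub-wild fibres SUBSUME the tame-pair deciders (gen 5) and, at a
# fibre with ONE index, reduce to the per-place window (abc-iut-D1-prv / abc-iut-w5-d009) — kernel-checked, no new statement of record

PROOF-ONLY record file (no `def`, no new `Prop`, no instance) of the abc-iut cell (prover seat abc-iut-w4-d006, gen 6; D-0079 R-W row
«W:T1½-PAIRS BALL-FIBRES lane=U», closing record). TAKES NO SIDE on [IUTchIII] Cor. 3.12 or on any author. Purpose (for the R-W TABLE pen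
and W-SPEC §2f «strata U1 / U1½ closed»): ONE deciding family for U1 ∪ U1½ at ANY fibre shape.

* §1 `subwild_of_tame` — at a place over an odd prime, `e(x|p) ≤ p − 2` implies `e(x|p) ≤ p − 1` and «no `ζ ≠ 1` with `ζ^p = 1` in `K_x`»
  (abc-iut-D1-prv's `forall_pow_prime_eq_one_of_absRamificationIdx_le_sub_two`): the hypothesis of `Cor312LicenceBallPairsRealising` /
  `…GenuineK` (p459585 / p459671) follows from the hypothesis of gen 5's `Cor312LicenceTamePairsRealising` / `…GenuineK` (p452603 / p452876).
* §2 two `example`s — gen 5's `licence_settingPrVolSharp_iff_of_realises_tame_pairs` and `Cor312Prov.licence_settingPrVolSharp_pilotDataOfK_iff_of_tame_pairs`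
  RE-DERIVED, statements verbatim, from the gen-6 boundary-pairs deciders (no second copy of any statement enters the tree).
* §3 `forall_pair_const_index_iff` — pure integer bookkeeping: when every bad place over `p` has the SAME index `e > 0`, the pair predicate
  `∀ bad w y: e·(e·min(D_w, D_y) + 1) ≤ e·P_w + j·e·(e − 1)` is equivalent to the per-place window `∀ bad w: e·D_w + 1 − j·(e − 1) ≤ P_w` of
  abc-iut-w5-d180 / abc-iut-w5-d009 / abc-iut-D1-prv (pair `(w, w)` one way, `min ≤ D_w` the other) — so at uniform fibres the pair rows of the
  table ARE the per-place rows.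
HONEST SCOPE: bookkeeping over OUR typed objects; nothing about the printed GLOBAL inequality; refuted-as-typed ≠ refuted-in-print; nothing
asserts or refutes [IUTchIII] Cor. 3.12; typed ≠ proved. [cite: DupuyHilado2025, §3.4, §4.9] [cite: NeukirchANT1999, Ch. II Prop. (5.7), (7.13)]
[claim: Mochizuki2012, status: disputed] for every IUT sentence quoted.
-/

noncomputable section

open Set Metric Function NumberField IsDedekindDomain
open scoped Pointwise

namespace Summit.ABC.IUTFork.Thm311.Real

open Cor312 Cor312.Setting Cor312Vol Literature.IUT.LogThetaLattice Literature.IUT.LogVolume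
open Literature.NumberTheory.NumberFields Literature.NumberTheory.GaloisRepresentations.Ultrametric

/-! ## §3 (stated first, no variables). One index per fibre: pairs ⟺ places -/

/-- **At a fibre with ONE index the pair predicate is the per-place window.** For `e > 0` and any `j`, `D`, `P` on a set of «bad» indices:
`(∀ bad w y, e·(e·min(D_w, D_y) + 1) ≤ e·P_w + j·e·(e − 1)) ↔ (∀ bad w, e·D_w + 1 − j·(e − 1) ≤ P_w)` — the pair `(w, w)` gives the window
(divide by `e`), and the window at `w` gives every pair through `min(D_w, D_y) ≤ D_w`. Pure integer bookkeeping for the R-W table.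
[cite: DupuyHilado2025, §4.9] -/
theorem forall_pair_const_index_iff {ι : Type*} (bad : ι → Prop) (D P : ι → ℤ) {e : ℤ} (j : ℤ) (he : 0 < e) :
    (∀ w y, bad w → bad y → e * (e * min (D w) (D y) + 1) ≤ e * P w + j * e * (e - 1)) ↔
      ∀ w, bad w → e * D w + 1 - j * (e - 1) ≤ P w := by
  constructor
  · intro h w hw
    have h1 := h w w hw hw
    rw [min_self] at h1
    have h2 : e * (e * D w + 1 - j * (e - 1)) ≤ e * P w := by nlinarith
    exact le_of_mul_le_mul_left h2 he
  · intro h w y hw _hy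
    have h1 := h w hw
    have hmin : min (D w) (D y) ≤ D w := min_le_left _ _
    nlinarith [mul_le_mul_of_nonneg_left hmin he.le]

/-! ## §1. Tame ⇒ torsion-free sub-wild, place by place (indices free to differ) -/

variable {F : Type} [Field F] [NumberField F] (X : PilotData F)

/-- **Gen 5's tame-fibre hypothesis implies the gen-6 boundary-fibre hypothesis**, place by place: at `x | p` with `p > 2` and `e(x|p) ≤ p − 2`,
also `e(x|p) ≤ p − 1` and `K_x` has no `ζ ≠ 1` with `ζ^p = 1` (abc-iut-D1-prv's `forall_pow_prime_eq_one_of_absRamificationIdx_le_sub_two` at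
`K_x`, `e(K_x/ℚ_p) = e(x|p)` by `absRamificationIdx_rescaledCompletion`). [cite: NeukirchANT1999, Ch. II Prop. (5.7), (7.13)] -/
theorem subwild_of_tame
    (htame : ∀ (pp : Nat.Primes) (x : (thetaIndex X).Fibre (.inr pp)),
      haveI : Fact (pp : ℕ).Prime := ⟨pp.2⟩
      (∃ w : (thetaIndex X).Fibre (.inr pp), placeOf X pp.1 w ∈ X.S) →
        2 < (pp : ℕ) ∧ (placeOf X pp.1 x).asIdeal.ramificationIdx ℤ ≤ (pp : ℕ) - 2)
    (pp : Nat.Primes) (x : (thetaIndex X).Fibre (.inr pp))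
    (hS : haveI : Fact (pp : ℕ).Prime := ⟨pp.2⟩; ∃ w : (thetaIndex X).Fibre (.inr pp), placeOf X pp.1 w ∈ X.S) :
    haveI : Fact (pp : ℕ).Prime := ⟨pp.2⟩
    2 < (pp : ℕ) ∧ (placeOf X pp.1 x).asIdeal.ramificationIdx ℤ ≤ (pp : ℕ) - 1 ∧ ∀ ζ : kOf X pp.1 x, ζ ^ (pp : ℕ) = 1 → ζ = 1 := by
  haveI : Fact (pp : ℕ).Prime := ⟨pp.2⟩
  obtain ⟨hp2, he⟩ := htame pp x hS
  have heK : absRamificationIdx (pp : ℕ) (kOf X pp.1 x) ≤ (pp : ℕ) - 2 :=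
    (absRamificationIdx_rescaledCompletion F (pp : ℕ) (placeOf X pp.1 x) (natCast_mem_placeOf X pp.1 x)).le.trans he
  exact ⟨hp2, by omega, forall_pow_prime_eq_one_of_absRamificationIdx_le_sub_two (pp : ℕ) (kOf X pp.1 x) hp2 heK⟩

end Summit.ABC.IUTFork.Thm311.Real

/-! ## §2. Gen 5's tame-pair deciders as the case `e(x|p) ≤ p − 2` of the boundary-pair deciders (re-derivations; no new declaration) -/

namespace Summit.ABC.IUTFork.Thm311.Real

open Cor312 Cor312.Setting Cor312Vol Cor312Vol.ExplicitDepth Literature.IUT.LogThetaLattice Literature.IUT.LogVolume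
open Literature.NumberTheory.NumberFields Literature.NumberTheory.GaloisRepresentations.Ultrametric

variable {F : Type} [Field F] [NumberField F] (X : PilotData F) {logv : PadicLogs F} (hlog : LogvAnalytic logv)
  (M : Type) [Field M] [NumberField M]
  (archPk : ∀ (j : (thetaIndex X).Label) (vQ : (thetaIndex X).VQ), Set ((logShellsDH X logv).Packet j vQ))
  (archSub : ∀ (j : (thetaIndex X).Label) (v : (thetaIndex X).V),
    Set ((logShellsDH X logv).Packet j ((thetaIndex X).over v)))
  (Ψ : ℤ → ∀ v : (thetaIndex X).V, v ∈ (thetaIndex X).Vbad → Set ((logShellsDH X logv).StarPacket v))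
  (act : ℤ → ∀ v : (thetaIndex X).V, v ∈ (thetaIndex X).Vbad →
    (logShellsDH X logv).StarPacket v → Module.End ℚ ((logShellsDH X logv).StarPacket v))
  (Mmod : ℤ → ∀ j : (thetaIndex X).LabelStar, Set ((logShellsDH X logv).GlobalPacket j.1))
  (region : ℤ → ∀ j : (thetaIndex X).LabelStar, FinDivisor M → ∀ vQ : (thetaIndex X).VQ,
    Set ((logShellsDH X logv).Packet j.1 vQ))
  (n : ℤ) {HT : Type} {LogLink : HT → HT → Type} {IsFull : ∀ {s t : HT}, LogLink s t → Prop}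
  (lat : LGPGaussianLogThetaLattice LogLink IsFull)
  {Frd : Type} {IsoF : Frd → Frd → Type} {Ob : Frd → Type} {realify : Frd → Frd} {Strip : Type}
  {IsoS : Strip → Strip → Type} {Mv : ∀ v : (thetaIndex X).V, v ∈ (thetaIndex X).Vbad → Type}
  [∀ v h, Monoid (Mv v h)]
  (sig : GlobalLGPFrobenioidSignature (thetaIndex X).lstar (thetaIndex X).V (· ∈ (thetaIndex X).Vbad)
    Frd IsoF Ob realify Strip IsoS Mv)
  (split : SplittingMonoids Mv) {ObΔ : Type} {N : ∀ v : (thetaIndex X).V, v ∈ (thetaIndex X).Vbad → Type}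
  [∀ v h, Monoid (N v h)] (qData : QPilotData ObΔ N)
  (tq : ∀ (pp : Nat.Primes) (x : (thetaIndex X).Fibre (.inr pp)), haveI : Fact (pp : ℕ).Prime := ⟨pp.2⟩; kOf X pp.1 x)
  (t : ∀ (pp : Nat.Primes) (_ : Fin X.lstar) (x : (thetaIndex X).Fibre (.inr pp)),
    haveI : Fact (pp : ℕ).Prime := ⟨pp.2⟩; kOf X pp.1 x)
  (htq0 : ∀ pp x, tq pp x ≠ 0)
  (htq1 : ∀ (pp : Nat.Primes) (x : (thetaIndex X).Fibre (.inr pp)),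
    haveI : Fact (pp : ℕ).Prime := ⟨pp.2⟩; placeOf X pp.1 x ∉ X.S → ‖tq pp x‖ = 1)
  (col : ℤ → Column (logShellsDH X logv))
  (ht0 : ∀ pp i x, t pp i x ≠ 0)
  (ht : ∀ (pp : Nat.Primes) (i : Fin X.lstar) (x : (thetaIndex X).Fibre (.inr pp)),
    haveI : Fact (pp : ℕ).Prime := ⟨pp.2⟩
    Real.log ‖t pp i x‖ = -(X.thetaPilot i (placeOf X pp.1 x)) * logNorm F (placeOf X pp.1 x) /
      localDegree F (placeOf X pp.1 x))
  (htq : ∀ (pp : Nat.Primes) (x : (thetaIndex X).Fibre (.inr pp)),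
    haveI : Fact (pp : ℕ).Prime := ⟨pp.2⟩
    Real.log ‖tq pp x‖ = -(X.qPilot (placeOf X pp.1 x)) * logNorm F (placeOf X pp.1 x) /
      localDegree F (placeOf X pp.1 x))

include ht0 ht htq in
/-- **Gen 5's `licence_settingPrVolSharp_iff_of_realises_tame_pairs` (p452603) RE-DERIVED from `…_of_realises_boundary_pairs` (p459585)**
through `subwild_of_tame` — statement copied verbatim; an `example`, so no second copy of the statement enters the tree.
[cite: DupuyHilado2025, §3.4, §4.9] [claim: Mochizuki2012, status: disputed] -/
example
    (htame : ∀ (pp : Nat.Primes) (x : (thetaIndex X).Fibre (.inr pp)),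
      haveI : Fact (pp : ℕ).Prime := ⟨pp.2⟩
      (∃ w : (thetaIndex X).Fibre (.inr pp), placeOf X pp.1 w ∈ X.S) →
        2 < (pp : ℕ) ∧ (placeOf X pp.1 x).asIdeal.ramificationIdx ℤ ≤ (pp : ℕ) - 2)
    (P : ∀ pp : Nat.Primes, (thetaIndex X).Fibre (.inr pp) → ℕ)
    (hP : ∀ (pp : Nat.Primes) (w : (thetaIndex X).Fibre (.inr pp)),
      haveI : Fact (pp : ℕ).Prime := ⟨pp.2⟩; placeOf X pp.1 w ∈ X.S → X.qPilot (placeOf X pp.1 w) = P pp w) :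
    Thm311ToCor312.Licence (settingPrVolSharp X hlog M archPk archSub Ψ act Mmod region n lat sig split qData tq t htq0 htq1) ↔
      ∀ (pp : Nat.Primes) (i : Fin (thetaIndex X).lstar) (w y : (thetaIndex X).Fibre (.inr pp)),
        haveI : Fact (pp : ℕ).Prime := ⟨pp.2⟩; placeOf X pp.1 w ∈ X.S → placeOf X pp.1 y ∈ X.S →
          ((placeOf X pp.1 y).asIdeal.ramificationIdx ℤ : ℤ) *
              (((placeOf X pp.1 w).asIdeal.ramificationIdx ℤ : ℤ) *
                min (((((i : ℕ) + 1 : ℕ) : ℤ) ^ 2 * (P pp w : ℤ) - 1) / ((placeOf X pp.1 w).asIdeal.ramificationIdx ℤ : ℤ))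
                  (((((i : ℕ) + 1 : ℕ) : ℤ) ^ 2 * (P pp y : ℤ) - 1) / ((placeOf X pp.1 y).asIdeal.ramificationIdx ℤ : ℤ)) + 1) ≤
            ((placeOf X pp.1 y).asIdeal.ramificationIdx ℤ : ℤ) * (P pp w : ℤ) +
              ((i : ℕ) + 1 : ℕ) * ((placeOf X pp.1 w).asIdeal.ramificationIdx ℤ : ℤ) *
                (((placeOf X pp.1 y).asIdeal.ramificationIdx ℤ : ℤ) - 1) :=
  licence_settingPrVolSharp_iff_of_realises_boundary_pairs X hlog M archPk archSub Ψ act Mmod region n lat sig split qData tq t htq0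
    htq1 ht0 ht htq (fun pp x hS => subwild_of_tame X htame pp x hS) P hP

end Summit.ABC.IUTFork.Thm311.Real

namespace Summit.ABC.IUTFork.Cor312Prov

open Thm311 Thm311.Real Cor312 Cor312.Setting Cor312Vol Literature.IUT.LogThetaLattice Literature.IUT.LogVolume
  Literature.IUT.HodgeTheaters
open Literature.NumberTheory.NumberFields Literature.NumberTheory.GaloisRepresentations.Ultrametric

variable {F K Fbar : Type} [Field F] [NumberField F] [Field K] [NumberField K] [Algebra F K] [Field Fbar]
  [Algebra F Fbar] [Algebra K Fbar] {E : WeierstrassCurve F} [E.IsElliptic] {l : ℕ} {Pb : BadPlacePredicates K}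
  (D : InitialThetaData F K Fbar E l Pb) {logv : PadicLogs K} (hlog : LogvAnalytic logv)
  (M : Type) [Field M] [NumberField M]
  (archPk : ∀ (j : (thetaIndex (pilotDataOfK D K)).Label) (vQ : (thetaIndex (pilotDataOfK D K)).VQ),
    Set ((logShellsDH (pilotDataOfK D K) logv).Packet j vQ))
  (archSub : ∀ (j : (thetaIndex (pilotDataOfK D K)).Label) (v : (thetaIndex (pilotDataOfK D K)).V),
    Set ((logShellsDH (pilotDataOfK D K) logv).Packet j ((thetaIndex (pilotDataOfK D K)).over v)))
  (Ψ : ℤ → ∀ v : (thetaIndex (pilotDataOfK D K)).V, v ∈ (thetaIndex (pilotDataOfK D K)).Vbad →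
    Set ((logShellsDH (pilotDataOfK D K) logv).StarPacket v))
  (act : ℤ → ∀ v : (thetaIndex (pilotDataOfK D K)).V, v ∈ (thetaIndex (pilotDataOfK D K)).Vbad →
    (logShellsDH (pilotDataOfK D K) logv).StarPacket v → Module.End ℚ ((logShellsDH (pilotDataOfK D K) logv).StarPacket v))
  (Mmod : ℤ → ∀ j : (thetaIndex (pilotDataOfK D K)).LabelStar, Set ((logShellsDH (pilotDataOfK D K) logv).GlobalPacket j.1))
  (region : ℤ → ∀ j : (thetaIndex (pilotDataOfK D K)).LabelStar, FinDivisor M → ∀ vQ : (thetaIndex (pilotDataOfK D K)).VQ,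
    Set ((logShellsDH (pilotDataOfK D K) logv).Packet j.1 vQ))
  (n : ℤ) {HT : Type} {LogLink : HT → HT → Type} {IsFull : ∀ {s t : HT}, LogLink s t → Prop}
  (lat : LGPGaussianLogThetaLattice LogLink IsFull)
  {Frd : Type} {IsoF : Frd → Frd → Type} {Ob : Frd → Type} {realify : Frd → Frd} {Strip : Type}
  {IsoS : Strip → Strip → Type} {Mv : ∀ v : (thetaIndex (pilotDataOfK D K)).V, v ∈ (thetaIndex (pilotDataOfK D K)).Vbad → Type}
  [∀ v h, Monoid (Mv v h)]
  (sig : GlobalLGPFrobenioidSignature (thetaIndex (pilotDataOfK D K)).lstar (thetaIndex (pilotDataOfK D K)).V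
    (· ∈ (thetaIndex (pilotDataOfK D K)).Vbad) Frd IsoF Ob realify Strip IsoS Mv)
  (split : SplittingMonoids Mv) {ObΔ : Type} {N : ∀ v : (thetaIndex (pilotDataOfK D K)).V, v ∈ (thetaIndex (pilotDataOfK D K)).Vbad → Type}
  [∀ v h, Monoid (N v h)] (qData : QPilotData ObΔ N)
  (tq : ∀ (pp : Nat.Primes) (x : (thetaIndex (pilotDataOfK D K)).Fibre (.inr pp)),
    haveI : Fact (pp : ℕ).Prime := ⟨pp.2⟩; kOf (pilotDataOfK D K) pp.1 x)
  (t : ∀ (pp : Nat.Primes) (_ : Fin (pilotDataOfK D K).lstar) (x : (thetaIndex (pilotDataOfK D K)).Fibre (.inr pp)),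
    haveI : Fact (pp : ℕ).Prime := ⟨pp.2⟩; kOf (pilotDataOfK D K) pp.1 x)
  (htq0 : ∀ pp x, tq pp x ≠ 0)
  (htq1 : ∀ (pp : Nat.Primes) (x : (thetaIndex (pilotDataOfK D K)).Fibre (.inr pp)),
    haveI : Fact (pp : ℕ).Prime := ⟨pp.2⟩; placeOf (pilotDataOfK D K) pp.1 x ∉ (pilotDataOfK D K).S → ‖tq pp x‖ = 1)
  (col : ℤ → Column (logShellsDH (pilotDataOfK D K) logv))
  (ht0 : ∀ pp i x, t pp i x ≠ 0)
  (ht : ∀ (pp : Nat.Primes) (i : Fin (pilotDataOfK D K).lstar) (x : (thetaIndex (pilotDataOfK D K)).Fibre (.inr pp)),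
    haveI : Fact (pp : ℕ).Prime := ⟨pp.2⟩
    Real.log ‖t pp i x‖ = -((pilotDataOfK D K).thetaPilot i (placeOf (pilotDataOfK D K) pp.1 x)) *
      logNorm K (placeOf (pilotDataOfK D K) pp.1 x) / localDegree K (placeOf (pilotDataOfK D K) pp.1 x))
  (htq : ∀ (pp : Nat.Primes) (x : (thetaIndex (pilotDataOfK D K)).Fibre (.inr pp)),
    haveI : Fact (pp : ℕ).Prime := ⟨pp.2⟩
    Real.log ‖tq pp x‖ = -((pilotDataOfK D K).qPilot (placeOf (pilotDataOfK D K) pp.1 x)) *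
      logNorm K (placeOf (pilotDataOfK D K) pp.1 x) / localDegree K (placeOf (pilotDataOfK D K) pp.1 x))

include ht0 ht htq in
/-- **Gen 5's `Cor312Prov.licence_settingPrVolSharp_pilotDataOfK_iff_of_tame_pairs` (p452876) RE-DERIVED from
`…_pilotDataOfK_iff_of_boundary_pairs` (p459671)** through `subwild_of_tame` — statement copied verbatim; an `example`.
[cite: DupuyHilado2025, §3.4, §4.9] [claim: Mochizuki2012, status: disputed] -/
example
    (htame : ∀ (pp : Nat.Primes) (x : (thetaIndex (pilotDataOfK D K)).Fibre (.inr pp)),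
      haveI : Fact (pp : ℕ).Prime := ⟨pp.2⟩
      (∃ w : (thetaIndex (pilotDataOfK D K)).Fibre (.inr pp), placeOf (pilotDataOfK D K) pp.1 w ∈ (pilotDataOfK D K).S) →
        2 < (pp : ℕ) ∧ (placeOf (pilotDataOfK D K) pp.1 x).asIdeal.ramificationIdx ℤ ≤ (pp : ℕ) - 2) :
    Thm311ToCor312.Licence
        (settingPrVolSharp (pilotDataOfK D K) hlog M archPk archSub Ψ act Mmod region n lat sig split qData tq t htq0 htq1) ↔
      ∀ (pp : Nat.Primes) (i : Fin (pilotDataOfK D K).lstar) (w y : (thetaIndex (pilotDataOfK D K)).Fibre (.inr pp)),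
        haveI : Fact (pp : ℕ).Prime := ⟨pp.2⟩
        placeOf (pilotDataOfK D K) pp.1 w ∈ (pilotDataOfK D K).S → placeOf (pilotDataOfK D K) pp.1 y ∈ (pilotDataOfK D K).S →
          ∀ Pw Py : ℕ, (pilotDataOfK D K).qPilot (placeOf (pilotDataOfK D K) pp.1 w) = Pw →
            (pilotDataOfK D K).qPilot (placeOf (pilotDataOfK D K) pp.1 y) = Py →
            ((placeOf (pilotDataOfK D K) pp.1 y).asIdeal.ramificationIdx ℤ : ℤ) *
                (((placeOf (pilotDataOfK D K) pp.1 w).asIdeal.ramificationIdx ℤ : ℤ) *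
                  min (((((i : ℕ) + 1 : ℕ) : ℤ) ^ 2 * (Pw : ℤ) - 1) / ((placeOf (pilotDataOfK D K) pp.1 w).asIdeal.ramificationIdx ℤ : ℤ))
                    (((((i : ℕ) + 1 : ℕ) : ℤ) ^ 2 * (Py : ℤ) - 1) / ((placeOf (pilotDataOfK D K) pp.1 y).asIdeal.ramificationIdx ℤ : ℤ)) +
                  1) ≤
              ((placeOf (pilotDataOfK D K) pp.1 y).asIdeal.ramificationIdx ℤ : ℤ) * (Pw : ℤ) +
                ((i : ℕ) + 1 : ℕ) * ((placeOf (pilotDataOfK D K) pp.1 w).asIdeal.ramificationIdx ℤ : ℤ) *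
                  (((placeOf (pilotDataOfK D K) pp.1 y).asIdeal.ramificationIdx ℤ : ℤ) - 1) :=
  licence_settingPrVolSharp_pilotDataOfK_iff_of_boundary_pairs D hlog M archPk archSub Ψ act Mmod region n lat sig split qData tq t htq0
    htq1 ht0 ht htq (fun pp x hS => subwild_of_tame (pilotDataOfK D K) htame pp x hS)

end Summit.ABC.IUTFork.Cor312Prov

end
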